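import Mathlib
import HarnessLib
import Literature.MathematicalPhysics.QuantumLattice.FermiRG.BGM2003Sectors
import Literature.MathematicalPhysics.QuantumLattice.HubbardFermiChordRigidity
import Summits.HubbardSuperconductivity.HubbardSuperconductivity.Theorems.KLProgrammeH10TwoPointLimitPerturbedSectorBox
import Summits.HubbardSuperconductivity.HubbardSuperconductivity.Theorems.KLProgrammeAbsUmklappLabelTriples
import Summits.HubbardSuperconductivity.HubbardSuperconductivity.Theorems.KLProgrammeAbsUmklappTripleWindows

/-!
# Route `KLProgramme` — K3 engine (stmt-HubbardSuperconductivity-20437), stub (b) (ℓ)/(I2)–(I3), located item «ABS-UMK-COUNT»: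
# the FIBRE BOUND of a narrow class — with all legs but a kept triple fixed, at most `T_bound` strings

Cell gate-hubbard-kl, seat p4 g15 (route HOME/prover-p4/UV-REMEASURE-COUNT.md §5).  A class of target strings (`Σ k = R`, `k_i ∈ S_{n′,ω_i}`, anchored at
`ω₁`) is cut out by a base leg `s`, a kept triple `a, b, c` and a side shift `σ ∈ {0, π}`: the kept legs' sector centres lie within torus distance `2Φ₀`
of `θ⋆ = θ_{n′,ω_s} + σ`.  Zeroing the kept legs projects the class onto «contexts» `ρ`; in the fibre over `ρ` the kept triple's chart values satisfy the
two windows of `tripleWindows_of_conservation` (sector boxes `h73` give displacements `≤ 4c₃2^{−n′}` in both frame directions), so the fibre injects into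
the label triples of `card_labelTriples_le`:

* `abs_unitNormal_apply_le_one`, `abs_unitTangent_apply_le_one` (via `abs_dot_unit_le_sqrt`), `abs_dotProduct_le_two`, `abs_boxDisplacement_dotProduct_le` — the sector-box
  displacement `k₁n⃗ + k₂τ⃗` has components `≤ 2(|k₁| + |k₂|)` along `e⃗_r(θ⋆)`, `e⃗_t(θ⋆)`;
* **`card_classFibre_le`** — every fibre of the projection has at most
  `T_bound = (2Lδ/h + 1)·960A_f(2(Lδ + B_f·Lδ) + (4B_f + 1)h)/(c_f² h²)` elements, `δ = 4c₃2^{−n′}`, `h = (s₁/2)·w_{n′}`, in the regime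
  `24 M₁Φ₀ + 3Lδ + 2h ≤ s₁Φ/4`, `2Φ₀ ≤ Φ`.

Everything is PROVED; no definitions, no named facts. [cite: BenfattoGiulianiMastropietro2003, §7.1 Lemma 7.3 (A1.13) and §7.4 p.28]
-/

noncomputable section

open Real Set
open Literature.MathematicalPhysics.QuantumLattice Literature.MathematicalPhysics.QuantumLattice.FermiRG
open Literature.MathematicalPhysics.QuantumLattice.FermiRG.BGM2003
open Summit.HubbardSuperconductivity.HubbardSuperconductivity.Theorems.ThinLevelSet
open Summit.HubbardSuperconductivity.HubbardSuperconductivity.Theorems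

namespace Summit.HubbardSuperconductivity.HubbardSuperconductivity.Theorems.AbsUmklappCount

set_option linter.dupNamespace false -- summit = problem name (single-conjunct summit), D-0017

/-! ## §1 Components of the sector-box displacement -/

/-- The components of BGM's unit normal are bounded by one. [cite: BenfattoGiulianiMastropietro2003, §7.1 (A1.7) p.26 (L45–50)] -/
theorem abs_unitNormal_apply_le_one (u : ℝ → ℝ → ℝ) (θ e : ℝ) (i : Fin 2) : |unitNormal u θ e i| ≤ 1 := by
  have hcs : Real.cos θ ^ 2 + Real.sin θ ^ 2 = 1 := by rw [add_comm]; exact Real.sin_sq_add_cos_sq θ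
  have hsc : Real.sin θ ^ 2 + Real.cos θ ^ 2 = 1 := Real.sin_sq_add_cos_sq θ
  rcases (Real.sqrt_nonneg (radiusDeriv u θ e ^ 2 + u θ e ^ 2)).eq_or_lt with h0 | hpos
  · simp only [unitNormal, speed, ← h0, inv_zero, zero_smul, Pi.zero_apply, abs_zero]; exact zero_le_one
  · have hs : speed u θ e = Real.sqrt (radiusDeriv u θ e ^ 2 + u θ e ^ 2) := rfl
    fin_cases i
    · simp only [unitNormal, Pi.smul_apply, Pi.sub_apply, smul_eq_mul, dir, tdir, Matrix.cons_val_zero, Fin.zero_eta]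
      rw [show (speed u θ e)⁻¹ * (u θ e * Real.cos θ - radiusDeriv u θ e * -Real.sin θ) =
        (speed u θ e)⁻¹ * (u θ e * Real.cos θ + radiusDeriv u θ e * Real.sin θ) by ring, abs_mul, abs_inv, hs, abs_of_pos hpos]
      rw [inv_mul_le_iff₀ hpos, mul_one]
      calc |u θ e * Real.cos θ + radiusDeriv u θ e * Real.sin θ| ≤ Real.sqrt (u θ e ^ 2 + radiusDeriv u θ e ^ 2) := abs_dot_unit_le_sqrt hcs
        _ = Real.sqrt (radiusDeriv u θ e ^ 2 + u θ e ^ 2) := by rw [add_comm]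
    · simp only [unitNormal, Pi.smul_apply, Pi.sub_apply, smul_eq_mul, dir, tdir, Matrix.cons_val_one, Fin.mk_one,
        Matrix.cons_val_zero]
      rw [show (speed u θ e)⁻¹ * (u θ e * Real.sin θ - radiusDeriv u θ e * Real.cos θ) =
        (speed u θ e)⁻¹ * (u θ e * Real.sin θ + (-radiusDeriv u θ e) * Real.cos θ) by ring, abs_mul, abs_inv, hs, abs_of_pos hpos]
      rw [inv_mul_le_iff₀ hpos, mul_one]
      calc |u θ e * Real.sin θ + -radiusDeriv u θ e * Real.cos θ| ≤ Real.sqrt (u θ e ^ 2 + (-radiusDeriv u θ e) ^ 2) := abs_dot_unit_le_sqrt hsc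
        _ = Real.sqrt (radiusDeriv u θ e ^ 2 + u θ e ^ 2) := by rw [neg_sq, add_comm]

/-- The components of BGM's unit tangent are bounded by one. [cite: BenfattoGiulianiMastropietro2003, §7.1 (A1.6) p.26 (L35–41)] -/
theorem abs_unitTangent_apply_le_one (u : ℝ → ℝ → ℝ) (θ e : ℝ) (i : Fin 2) : |unitTangent u θ e i| ≤ 1 := by
  have hcs : Real.cos θ ^ 2 + Real.sin θ ^ 2 = 1 := by rw [add_comm]; exact Real.sin_sq_add_cos_sq θ
  have hsc : Real.sin θ ^ 2 + Real.cos θ ^ 2 = 1 := Real.sin_sq_add_cos_sq θ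
  rcases (Real.sqrt_nonneg (radiusDeriv u θ e ^ 2 + u θ e ^ 2)).eq_or_lt with h0 | hpos
  · simp only [unitTangent, speed, ← h0, inv_zero, zero_smul, Pi.zero_apply, abs_zero]; exact zero_le_one
  · have hs : speed u θ e = Real.sqrt (radiusDeriv u θ e ^ 2 + u θ e ^ 2) := rfl
    fin_cases i
    · simp only [unitTangent, Pi.smul_apply, Pi.add_apply, smul_eq_mul, dir, tdir, Matrix.cons_val_zero, Fin.zero_eta]
      rw [show (speed u θ e)⁻¹ * (radiusDeriv u θ e * Real.cos θ + u θ e * -Real.sin θ) =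
        (speed u θ e)⁻¹ * (radiusDeriv u θ e * Real.cos θ + (-u θ e) * Real.sin θ) by ring, abs_mul, abs_inv, hs, abs_of_pos hpos]
      rw [inv_mul_le_iff₀ hpos, mul_one]
      calc |radiusDeriv u θ e * Real.cos θ + -u θ e * Real.sin θ| ≤ Real.sqrt (radiusDeriv u θ e ^ 2 + (-u θ e) ^ 2) := abs_dot_unit_le_sqrt hcs
        _ = Real.sqrt (radiusDeriv u θ e ^ 2 + u θ e ^ 2) := by rw [neg_sq]
    · simp only [unitTangent, Pi.smul_apply, Pi.add_apply, smul_eq_mul, dir, tdir, Matrix.cons_val_one, Fin.mk_one,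
        Matrix.cons_val_zero]
      rw [abs_mul, abs_inv, hs, abs_of_pos hpos, inv_mul_le_iff₀ hpos, mul_one]
      calc |radiusDeriv u θ e * Real.sin θ + u θ e * Real.cos θ| ≤ Real.sqrt (radiusDeriv u θ e ^ 2 + u θ e ^ 2) := abs_dot_unit_le_sqrt hsc
        _ = Real.sqrt (radiusDeriv u θ e ^ 2 + u θ e ^ 2) := rfl

/-- `|v·w| ≤ 2` for two vectors of `Fin 2 → ℝ` with components bounded by one. [folklore] -/
theorem abs_dotProduct_le_two {v w : Fin 2 → ℝ} (hv : ∀ i, |v i| ≤ 1) (hw : ∀ i, |w i| ≤ 1) : |v ⬝ᵥ w| ≤ 2 := by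
  rw [dotProduct, Fin.sum_univ_two]
  have h0 : |v 0 * w 0| ≤ 1 := by rw [abs_mul]; nlinarith [hv 0, hw 0, abs_nonneg (v 0), abs_nonneg (w 0)]
  have h1 : |v 1 * w 1| ≤ 1 := by rw [abs_mul]; nlinarith [hv 1, hw 1, abs_nonneg (v 1), abs_nonneg (w 1)]
  calc |v 0 * w 0 + v 1 * w 1| ≤ |v 0 * w 0| + |v 1 * w 1| := abs_add_le _ _
    _ ≤ 2 := by linarith

/-- `|e⃗_t(θ)_i| ≤ 1`. [folklore] -/
theorem abs_tdir_le_one (θ : ℝ) (i : Fin 2) : |tdir θ i| ≤ 1 := by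
  fin_cases i
  · simp only [tdir, Matrix.cons_val_zero, Fin.zero_eta, abs_neg]; exact Real.abs_sin_le_one θ
  · simp only [tdir, Matrix.cons_val_one, Fin.mk_one, Matrix.cons_val_zero]; exact Real.abs_cos_le_one θ

/-- The sector-box displacement `k₁n⃗(θ_c) + k₂τ⃗(θ_c)` has component `≤ 2(|k₁| + |k₂|)` along any `w` with `|w_i| ≤ 1`. [folklore] -/
theorem abs_boxDisplacement_dotProduct_le (u : ℝ → ℝ → ℝ) (θc k₁ k₂ : ℝ) {w : Fin 2 → ℝ} (hw : ∀ i, |w i| ≤ 1) :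
    |(k₁ • unitNormal u θc 0 + k₂ • unitTangent u θc 0) ⬝ᵥ w| ≤ 2 * (|k₁| + |k₂|) := by
  rw [add_dotProduct, smul_dotProduct, smul_dotProduct, smul_eq_mul, smul_eq_mul]
  have h1 := abs_dotProduct_le_two (abs_unitNormal_apply_le_one u θc 0) hw
  have h2 := abs_dotProduct_le_two (abs_unitTangent_apply_le_one u θc 0) hw
  calc |k₁ * unitNormal u θc 0 ⬝ᵥ w + k₂ * unitTangent u θc 0 ⬝ᵥ w|
      ≤ |k₁ * unitNormal u θc 0 ⬝ᵥ w| + |k₂ * unitTangent u θc 0 ⬝ᵥ w| := abs_add_le _ _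
    _ = |k₁| * |unitNormal u θc 0 ⬝ᵥ w| + |k₂| * |unitTangent u θc 0 ⬝ᵥ w| := by rw [abs_mul, abs_mul]
    _ ≤ |k₁| * 2 + |k₂| * 2 := add_le_add (mul_le_mul_of_nonneg_left h1 (abs_nonneg _)) (mul_le_mul_of_nonneg_left h2 (abs_nonneg _))
    _ = 2 * (|k₁| + |k₂|) := by ring

/-! ## §2 The fibre bound -/

open Classical in
/-- **The fibre bound of a narrow class.**  See the module docstring: in the class of target strings anchored at `ω₁` with kept legs `a, b, c` within
torus distance `2Φ₀` of `θ⋆ = θ_{n′,ω_s} + σ`, the strings with prescribed values `ρ` off the kept legs (fibre of the projection zeroing `a, b, c`) number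
at most `T_bound`. [cite: BenfattoGiulianiMastropietro2003, §7.4 p.28 (L33–52)] -/
theorem card_classFibre_le {ε : (Fin 2 → ℝ) → ℝ} {μ e₀ : ℝ} {u : ℝ → ℝ → ℝ} (hD : DispersionHyp ε μ e₀ u) {c₃ : ℝ} (hc₃ : 0 < c₃)
    (h73 : ∀ (n ω : ℕ), ω < sectorCount n → ∀ p ∈ sSector u e₀ n ω,
      ∃ k₁ k₂ : ℝ,
        p = fermiPoint u (sectorCenter n ω) + k₁ • unitNormal u (sectorCenter n ω) 0 +
              k₂ • unitTangent u (sectorCenter n ω) 0 ∧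
        |k₁| ≤ c₃ * (4 : ℝ) ^ (-(n : ℤ)) ∧ |k₂| ≤ c₃ * (2 : ℝ) ^ (-(n : ℤ)) ∧
        |fderiv ℝ ε p (unitTangent u (sectorCenter n ω) 0)| ≤ c₃ * (2 : ℝ) ^ (-(n : ℤ)))
    {s₁ Φ cf Af Bf M₁ : ℝ} (hs₁ : 0 < s₁) (hM₁ : 0 ≤ M₁) (hΦ : 0 < Φ) (hcf : 0 < cf) (hcfA : cf ≤ Af) (hBf : 0 ≤ Bf)
    (hchart : ∀ θs : ℝ, ∃ f f' f'' : ℝ → ℝ, Measurable f ∧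
        (∀ φ ∈ Icc (-Φ) Φ,
          f ((fermiPoint u (θs + φ) - fermiPoint u θs) ⬝ᵥ tdir θs) = -((fermiPoint u (θs + φ) - fermiPoint u θs) ⬝ᵥ dir θs)) ∧
        (∀ y ∈ Icc (-(s₁ / 4 * Φ)) (s₁ / 4 * Φ), HasDerivAt f (f' y) y ∧ HasDerivAt f' (f'' y) y ∧
          cf ≤ f'' y ∧ f'' y ≤ Af ∧ |f' y| ≤ Bf) ∧
        (∀ φ ∈ Icc (-Φ) Φ, ∀ φ' ∈ Icc (-Φ) Φ,
          s₁ / 2 * |φ - φ'| ≤ |(fermiPoint u (θs + φ) - fermiPoint u θs) ⬝ᵥ tdir θs - (fermiPoint u (θs + φ') - fermiPoint u θs) ⬝ᵥ tdir θs| ∧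
          |(fermiPoint u (θs + φ) - fermiPoint u θs) ⬝ᵥ tdir θs - (fermiPoint u (θs + φ') - fermiPoint u θs) ⬝ᵥ tdir θs| ≤ M₁ * |φ - φ'|) ∧
        (fermiPoint u (θs + 0) - fermiPoint u θs) ⬝ᵥ tdir θs = 0)
    {n' L : ℕ} (i₁ s a b c : Fin L) (hsa : s ≠ a) (hsb : s ≠ b) (hsc : s ≠ c)
    (hab : a ≠ b) (hac : a ≠ c) (hbc : b ≠ c) (ω₁ : ℕ) (R : Fin 2 → ℝ) {Φ₀ : ℝ} (hΦ₀ : 0 ≤ Φ₀) (h2Φ₀ : 2 * Φ₀ ≤ Φ) (σ : ℝ)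
    (hreg : 6 * (M₁ * (2 * Φ₀)) + 3 * (L * (4 * c₃ * (2 : ℝ) ^ (-(n' : ℤ)))) + 2 * (s₁ / 2 * sectorWidth n') ≤ s₁ / 4 * Φ)
    (ρ : Fin L → Fin (sectorCount n')) :
    ((((Finset.univ : Finset (Fin L → Fin (sectorCount n'))).filter fun ω =>
        (ω i₁ : ℕ) = ω₁ ∧ (∀ i j : Fin L, i ≠ i₁ → j ≠ i₁ → pairAngle (sectorCenter n' (ω i)) (sectorCenter n' (ω j)) ≤ Φ₀) ∧
        (∀ x ∈ ({a, b, c} : Finset (Fin L)), torusDist (sectorCenter n' (ω x) - (sectorCenter n' (ω s) + σ)) ≤ 2 * Φ₀) ∧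
        ∃ k : Fin L → (Fin 2 → ℝ), (∀ i, k i ∈ sSector u e₀ n' (ω i : ℕ)) ∧ ∑ i, k i = R).filter
        fun ω => Function.update (Function.update (Function.update ω a ⟨0, sectorCount_pos n'⟩) b ⟨0, sectorCount_pos n'⟩) c
          ⟨0, sectorCount_pos n'⟩ = ρ).card : ℝ) ≤
      (2 * (L * (4 * c₃ * (2 : ℝ) ^ (-(n' : ℤ)))) / (s₁ / 2 * sectorWidth n') + 1) *
        (960 * Af * (2 * (L * (4 * c₃ * (2 : ℝ) ^ (-(n' : ℤ))) + Bf * (L * (4 * c₃ * (2 : ℝ) ^ (-(n' : ℤ))))) +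
          (4 * Bf + 1) * (s₁ / 2 * sectorWidth n')) / cf ^ 2 / (s₁ / 2 * sectorWidth n') ^ 2) := by
  set z : Fin (sectorCount n') := ⟨0, sectorCount_pos n'⟩ with hz
  set δ : ℝ := 4 * c₃ * (2 : ℝ) ^ (-(n' : ℤ)) with hδ
  have hδ0 : 0 ≤ δ := by rw [hδ]; positivity
  set θs : ℝ := sectorCenter n' (ρ s) + σ with hθs
  obtain ⟨f, f', f'', hfm, hval, hder, hlip, hU0⟩ := hchart θs
  -- the label-triple set of `card_labelTriples_le` at `θ⋆`, with the context vector `Q`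
  set Q : Fin 2 → ℝ := R - ∑ i ∈ Finset.univ \ {a, b, c}, fermiPoint u (sectorCenter n' (ρ i)) - (3 : ℝ) • fermiPoint u θs with hQ
  set T := (Finset.univ : Finset ((Fin (sectorCount n') × Fin (sectorCount n')) × Fin (sectorCount n'))).filter
        fun t => torusDist (sectorCenter n' t.1.1 - θs) ≤ 2 * Φ₀ ∧ torusDist (sectorCenter n' t.1.2 - θs) ≤ 2 * Φ₀ ∧
          torusDist (sectorCenter n' t.2 - θs) ≤ 2 * Φ₀ ∧
          |(fermiPoint u (θs + (sectorCenter n' t.1.1 - θs - round ((2 * π)⁻¹ * (sectorCenter n' t.1.1 - θs)) * (2 * π))) -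
                fermiPoint u θs) ⬝ᵥ tdir θs +
              (fermiPoint u (θs + (sectorCenter n' t.1.2 - θs - round ((2 * π)⁻¹ * (sectorCenter n' t.1.2 - θs)) * (2 * π))) -
                fermiPoint u θs) ⬝ᵥ tdir θs +
              (fermiPoint u (θs + (sectorCenter n' t.2 - θs - round ((2 * π)⁻¹ * (sectorCenter n' t.2 - θs)) * (2 * π))) -
                fermiPoint u θs) ⬝ᵥ tdir θs - Q ⬝ᵥ tdir θs| ≤ L * δ ∧
          |f ((fermiPoint u (θs + (sectorCenter n' t.1.1 - θs - round ((2 * π)⁻¹ * (sectorCenter n' t.1.1 - θs)) * (2 * π))) -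
                fermiPoint u θs) ⬝ᵥ tdir θs) +
              f ((fermiPoint u (θs + (sectorCenter n' t.1.2 - θs - round ((2 * π)⁻¹ * (sectorCenter n' t.1.2 - θs)) * (2 * π))) -
                fermiPoint u θs) ⬝ᵥ tdir θs) +
              f ((fermiPoint u (θs + (sectorCenter n' t.2 - θs - round ((2 * π)⁻¹ * (sectorCenter n' t.2 - θs)) * (2 * π))) -
                fermiPoint u θs) ⬝ᵥ tdir θs) - -(Q ⬝ᵥ dir θs)| ≤ L * δ with hT
  have hTcard : (T.card : ℝ) ≤ (2 * (L * δ) / (s₁ / 2 * sectorWidth n') + 1) *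
      (960 * Af * (2 * (L * δ + Bf * (L * δ)) + (4 * Bf + 1) * (s₁ / 2 * sectorWidth n')) / cf ^ 2 / (s₁ / 2 * sectorWidth n') ^ 2) :=
    card_labelTriples_le (U := fun φ => (fermiPoint u (θs + φ) - fermiPoint u θs) ⬝ᵥ tdir θs) hfm
      (half_pos hs₁) hM₁ hΦ.le (by positivity) h2Φ₀ (fun φ hφ φ' hφ' => (hlip φ hφ φ' hφ').1)
      (fun φ hφ φ' hφ' => (hlip φ hφ φ' hφ').2) hU0 hcf hcfA hBf (by positivity) (by positivity) n' hreg
      (fun y hy => (hder y hy).1) (fun y hy => (hder y hy).2.1) (fun y hy => (hder y hy).2.2.1)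
      (fun y hy => (hder y hy).2.2.2.1) (fun y hy => (hder y hy).2.2.2.2) θs (Q ⬝ᵥ tdir θs) (-(Q ⬝ᵥ dir θs))
  -- the fibre and its injection into `T`
  set Fib := (((Finset.univ : Finset (Fin L → Fin (sectorCount n'))).filter fun ω =>
        (ω i₁ : ℕ) = ω₁ ∧ (∀ i j : Fin L, i ≠ i₁ → j ≠ i₁ → pairAngle (sectorCenter n' (ω i)) (sectorCenter n' (ω j)) ≤ Φ₀) ∧
        (∀ x ∈ ({a, b, c} : Finset (Fin L)), torusDist (sectorCenter n' (ω x) - (sectorCenter n' (ω s) + σ)) ≤ 2 * Φ₀) ∧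
        ∃ k : Fin L → (Fin 2 → ℝ), (∀ i, k i ∈ sSector u e₀ n' (ω i : ℕ)) ∧ ∑ i, k i = R).filter
        fun ω => Function.update (Function.update (Function.update ω a z) b z) c z = ρ) with hFib
  set e : (Fin L → Fin (sectorCount n')) → (Fin (sectorCount n') × Fin (sectorCount n')) × Fin (sectorCount n') := fun ω => ((ω a, ω b), ω c) with he
  -- off the kept legs a fibre element agrees with `ρ`
  have hoff : ∀ ω : Fin L → Fin (sectorCount n'), Function.update (Function.update (Function.update ω a z) b z) c z = ρ →
      ∀ i, i ≠ a → i ≠ b → i ≠ c → ω i = ρ i := by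
    intro ω hω i hia' hib' hic'
    have h1 := congrFun hω i
    rw [Function.update_of_ne hic', Function.update_of_ne hib', Function.update_of_ne hia'] at h1
    exact h1
  have hmemFib : ∀ ω ∈ Fib, ((ω i₁ : ℕ) = ω₁ ∧
      (∀ i j : Fin L, i ≠ i₁ → j ≠ i₁ → pairAngle (sectorCenter n' (ω i)) (sectorCenter n' (ω j)) ≤ Φ₀) ∧
      (∀ x ∈ ({a, b, c} : Finset (Fin L)), torusDist (sectorCenter n' (ω x) - (sectorCenter n' (ω s) + σ)) ≤ 2 * Φ₀) ∧
      ∃ k : Fin L → (Fin 2 → ℝ), (∀ i, k i ∈ sSector u e₀ n' (ω i : ℕ)) ∧ ∑ i, k i = R) ∧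
      Function.update (Function.update (Function.update ω a z) b z) c z = ρ := by
    intro ω hω
    rw [hFib, Finset.mem_filter, Finset.mem_filter] at hω
    exact ⟨hω.1.2, hω.2⟩
  have hinj : Set.InjOn e Fib := by
    intro ω hω ω' hω' hee
    have h1 := (hmemFib ω (by simpa using hω)).2
    have h2 := (hmemFib ω' (by simpa using hω')).2
    rw [he] at hee
    simp only [Prod.mk.injEq] at hee
    obtain ⟨⟨ea, eb⟩, ec⟩ := hee
    funext i
    by_cases hia' : i = a
    · rw [hia']; exact ea
    by_cases hib' : i = b
    · rw [hib']; exact eb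
    by_cases hic' : i = c
    · rw [hic']; exact ec
    rw [hoff ω h1 i hia' hib' hic', hoff ω' h2 i hia' hib' hic']
  have hmaps : Set.MapsTo e Fib T := by
    intro ω hω
    obtain ⟨⟨-, -, hcone, k, hk, hsum⟩, hupd⟩ := hmemFib ω (by simpa using hω)
    have hωs : ω s = ρ s := hoff ω hupd s hsa hsb hsc
    have hθs' : sectorCenter n' (ω s) + σ = θs := by rw [hθs, hωs]
    have hca : torusDist (sectorCenter n' (ω a) - θs) ≤ 2 * Φ₀ := by rw [← hθs']; exact hcone a (by simp)
    have hcb : torusDist (sectorCenter n' (ω b) - θs) ≤ 2 * Φ₀ := by rw [← hθs']; exact hcone b (by simp)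
    have hcc : torusDist (sectorCenter n' (ω c) - θs) ≤ 2 * Φ₀ := by rw [← hθs']; exact hcone c (by simp)
    -- sector boxes
    have hbox := fun i => h73 n' (ω i) (ω i).isLt (k i) (hk i)
    choose k₁ k₂ hdec hk₁ hk₂ _hk₃ using hbox
    set d : Fin L → (Fin 2 → ℝ) := fun i => k₁ i • unitNormal u (sectorCenter n' (ω i)) 0 + k₂ i • unitTangent u (sectorCenter n' (ω i)) 0
      with hd
    have hkd : ∀ i, k i = fermiPoint u (sectorCenter n' (ω i)) + d i := fun i => by rw [hdec i, hd]; simp only; rw [add_assoc]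
    have hkk : ∀ i, 2 * (|k₁ i| + |k₂ i|) ≤ δ := by
      intro i
      have h4 := PerturbedFermiCurve.four_zpow_neg_le_two_zpow_neg n'
      have h1 : |k₁ i| ≤ c₃ * (2 : ℝ) ^ (-(n' : ℤ)) := (hk₁ i).trans (mul_le_mul_of_nonneg_left h4 hc₃.le)
      rw [hδ]; linarith [hk₂ i]
    have hdt : ∀ i, |d i ⬝ᵥ tdir θs| ≤ δ := fun i =>
      (abs_boxDisplacement_dotProduct_le u _ _ _ (abs_tdir_le_one θs)).trans (hkk i)
    have hdn : ∀ i, |d i ⬝ᵥ dir θs| ≤ δ := fun i =>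
      (abs_boxDisplacement_dotProduct_le u _ _ _ (abs_dir_le_one θs)).trans (hkk i)
    -- the kept legs in the chart
    set φ : Fin L → ℝ := fun x => sectorCenter n' (ω x) - θs - round ((2 * π)⁻¹ * (sectorCenter n' (ω x) - θs)) * (2 * π) with hφ
    set j : Fin L → ℤ := fun x => round ((2 * π)⁻¹ * (sectorCenter n' (ω x) - θs)) with hj
    have hθ : ∀ x ∈ ({a, b, c} : Finset (Fin L)), sectorCenter n' (ω x) = θs + φ x + j x * (2 * π) := by
      intro x _; rw [hφ, hj]; simp only; ring
    have hφΦ : ∀ x ∈ ({a, b, c} : Finset (Fin L)), φ x ∈ Icc (-Φ) Φ := by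
      intro x hx
      have hcx : torusDist (sectorCenter n' (ω x) - θs) ≤ 2 * Φ₀ := by rw [← hθs']; exact hcone x hx
      have := abs_le.1 ((abs_rep_le_of_torusDist_le hcx).trans h2Φ₀)
      exact ⟨this.1, this.2⟩
    obtain ⟨hwt, hwn⟩ := tripleWindows_of_conservation (hD.periodic_u 0) (fun i => sectorCenter n' (ω i)) k d R hkd hsum θs hdt hdn
      hab hac hbc φ j hθ hval hφΦ
    -- the context vector is `Q`
    have hQω : R - ∑ i ∈ Finset.univ \ {a, b, c}, fermiPoint u (sectorCenter n' (ω i)) - (3 : ℝ) • fermiPoint u θs = Q := by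
      rw [hQ]
      congr 2
      refine Finset.sum_congr rfl fun i hi => ?_
      rw [Finset.mem_sdiff] at hi
      have hi' : i ≠ a ∧ i ≠ b ∧ i ≠ c := by simpa using hi.2
      rw [hoff ω hupd i hi'.1 hi'.2.1 hi'.2.2]
    rw [hQω] at hwt hwn
    show e ω ∈ (T : Set ((Fin (sectorCount n') × Fin (sectorCount n')) × Fin (sectorCount n')))
    rw [Finset.mem_coe, hT, Finset.mem_filter]
    refine ⟨Finset.mem_univ _, hca, hcb, hcc, hwt, ?_⟩
    rw [sub_neg_eq_add]
    exact hwn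
  have hcard : Fib.card ≤ T.card := Finset.card_le_card_of_injOn e hmaps hinj
  have h1 : (Fib.card : ℝ) ≤ (T.card : ℝ) := by exact_mod_cast hcard
  exact h1.trans hTcard

end Summit.HubbardSuperconductivity.HubbardSuperconductivity.Theorems.AbsUmklappCount

end
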